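import Summits.CriticalPhenomena.Ising3DConformalLimit.Theses.PrecisionLaplacian
import Summits.CriticalPhenomena.Ising3DConformalLimit.Theorems.PrecisionLaplacianEtaBoundsTransferPackage
import Summits.CriticalPhenomena.Ising3DConformalLimit.Theorems.PrecisionLaplacianEtaBoundsTransferTransfer
import Summits.CriticalPhenomena.Ising3DConformalLimit.Theorems.PrecisionLaplacianEtaBoundsTransferShell
import HarnessLib

/-!
# `EtaBoundsTransfer` (item stmt-CriticalPhenomena-4804), proved unconditionally

`theorem etaBoundsTransfer_proof : Summit.CriticalPhenomena.Ising3DConformalLimit.Theses.PrecisionLaplacian.EtaBoundsTransfer`.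

Under the symmetric-potential hypothesis for the critical kernel `G = ⟨σ₀σ_x⟩_{β_c}` on `ℤ³` and two-sided
tail bounds `a(x) ≍ ‖x‖^{-(5−η)}` (`0 < η < 1`) on the direct correlation function, `HasIsingEtaBounds 3 η`
holds. The planner's sketch went through Bass–Levin heat-kernel bounds (a named fact); this proof avoids
any unproved input: (1) inverse-M potential theory along boxes (`…Potential`, `…Limit`, `…Equation`) gives
`A₀G − a∗G = δ` with no defect, and `χ(β_c) = ∞` (Simon–Lieb lower bound, tree) forces no killing and the
Green representation `G = A₀⁻¹∑ q^{∗n}` (`…Green`, `…Package`); (2) Fourier analysis on `[-π,π]³`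
(`…Trig`, `…Ortho`, `…Fourier`, `…Integral`) bounds block sums `∑_{Λ_m²} G(y−y') ≲ m^{5−η}`; (3) a
quadratic test function (`…TestFn`, `…Shell`) bounds ball sums below by `R^{2−η}`; (4) the tree's
Messager–Miracle-Solé monotonicity (`twoPointFree_le_of_mul_supNorm_le`) converts averaged bounds into
pointwise ones (`…Transfer`). Axioms: `propext`, `Classical.choice`, `Quot.sound`.
-/

namespace Summit.CriticalPhenomena.Ising3DConformalLimit.Theorems

open Finset Real Filter Topology Literature.Probability.LatticeModels
open Summit.CriticalPhenomena.Ising3DConformalLimit.Theorems.EtaBoundsTransfer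
open scoped BigOperators

/-- **Item `stmt-CriticalPhenomena-4804` (`EtaBoundsTransfer`), proved unconditionally.**
Under the symmetric-potential hypothesis for the critical kernel `G = ⟨σ₀σ_x⟩_{β_c}` of `ℤ³`
(every finite `G_A` positive definite with Z-matrix inverse and nonnegative inverse row sums) and
two-sided tail bounds `c‖x‖^{-(5−η)} ≤ a(x) ≤ C‖x‖^{-(5−η)}` (`0 < η < 1`) on the direct
correlation function `a(x) = inf_A −(G_A⁻¹)(0,x)`, the critical two-point function obeys
`HasIsingEtaBounds 3 η`: `c'‖x‖^{-(1+η)} ≤ ⟨σ₀σ_x⟩_{β_c} ≤ C'‖x‖^{-(1+η)}`.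

Proof (no heat-kernel input): (1) potential theory of inverse M-matrices along boxes gives the
infinite-volume equation `A₀G − a∗G = δ` with no defect (`G → 0`) and, since `χ(β_c) = ∞`, no
killing (`∑a = A₀`), whence the Green-function representation `G = A₀⁻¹∑_n q^{∗n}`, `q = a/A₀`
(minimal solution plus a `q`-harmonic function vanishing at infinity); (2) Fourier analysis on
`[-π,π]³`: the symbol `ψ(k) = ∑ a(y)(1−cos k·y) ≥ c|k|^{2−η}`, Parseval for the convolution powers
against the box weight `|∑_{Λ_m} e^{ik·y}|² = ∏ D_m(k_j)²`, geometric partial sums and the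
Brillouin-zone integral `∫|k|^{η−2}∏D_m² ≲ m^{5−η}` bound the block sums `∑_{y,y'∈Λ_m}G(y−y')`;
(3) pairing the equation with the quadratic bump `(1−|u|²/R²)₊` bounds the ball sums below by
`R^{2−η}`; (4) the Messager–Miracle-Solé monotonicity of `⟨σ₀σ_x⟩` across scales (tree) turns the
averaged bounds into pointwise ones. -/
theorem etaBoundsTransfer_proof :
    Summit.CriticalPhenomena.Ising3DConformalLimit.Theses.PrecisionLaplacian.EtaBoundsTransfer := by
  intro hSP η hη0 hη1 hbd
  obtain ⟨c, C, hc, hbd⟩ := hbd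
  -- the Green package
  obtain ⟨A₀, b, P, hA0, hb0, hbs, hbev, hbA, hblow, hbup, heq, hP0, hPs, hPnn, hPsum, hPn, hG, hGnn, hGle⟩ :=
    green_package hSP hc hbd
  -- `C > 0` (test the two bounds at a unit vector)
  have hCpos : 0 < C := by
    set e : Site 3 := Pi.single 0 1 with he
    have he0 : e ≠ 0 := by
      intro h; have := congr_fun h 0; simp [he] at this
    have hn : 0 < ‖e‖ := norm_pos_iff.2 he0
    have h1 := hblow e he0
    have h2 := hbup e he0
    have ht : 0 < ‖e‖ ^ (-(5 - η)) := Real.rpow_pos_of_pos hn _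
    nlinarith
  -- block sums and the pointwise upper bound
  obtain ⟨K₁, hK₁, hblock⟩ :=
    block_sum_upper hη0 hη1 hc hA0 hb0 hbs hbev hbA hblow hP0 hPs hPnn hPsum hPn hG
  obtain ⟨C', hC'⟩ := pointwise_upper hη0 hη1 hK₁ hblock hGle
  -- box sums from below and above, and the pointwise lower bound
  have hα1 : 1 < 2 - η := by linarith
  have hα2 : 2 - η < 2 := by linarith
  have hbup' : ∀ y : Site 3, y ≠ 0 → b y ≤ C * ‖y‖ ^ (-(((3 : ℕ) : ℝ) + (2 - η))) := by
    intro y hy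
    have := hbup y hy
    rw [show -(5 - η) = -(((3 : ℕ) : ℝ) + (2 - η)) by push_cast; ring] at this
    exact this
  have hbsl : ∀ R : ℕ, 1 ≤ R → (R : ℝ) ^ (2 - η) /
      (C * (2 * (3 : ℕ) * 3 ^ ((3 : ℕ) - 1)) * (((3 : ℕ) : ℝ) * (1 + 1 / (2 - (2 - η))) + 1 / (2 - η)))
        ≤ ∑ u ∈ box 3 R, criticalTwoPoint 3 u :=
    fun R hR => box_sum_lower (d := 3) (by norm_num) hGnn hGle hb0 hbs hbev hbA heq hCpos hα1 hα2 hbup' hR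
  have hbsu : ∀ L : ℕ, 1 ≤ L → ∑ u ∈ box 3 L, criticalTwoPoint 3 u ≤ 8 * K₁ * 5 ^ (2 - η) * (L : ℝ) ^ (2 - η) :=
    fun L hL => box_sum_upper hη1 hK₁ hblock hGnn hL
  have hCs : 0 < C * (2 * (3 : ℕ) * 3 ^ ((3 : ℕ) - 1)) * (((3 : ℕ) : ℝ) * (1 + 1 / (2 - (2 - η))) + 1 / (2 - η)) := by
    have : (0 : ℝ) < 2 - (2 - η) := by linarith
    have : (0 : ℝ) < 2 - η := by linarith
    positivity
  have hK₂ : 0 < 8 * K₁ * (5 : ℝ) ^ (2 - η) := by positivity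
  obtain ⟨c', hc', hlow⟩ := pointwise_lower hη0 hη1 hCs hK₂ hbsl hbsu hGnn
  -- assemble `HasIsingEtaBounds 3 η`
  show ∃ c'' C'' : ℝ, 0 < c'' ∧ ∀ x, x ≠ 0 →
    c'' * (‖x‖ : ℝ) ^ (-(((3 : ℕ) : ℝ) - 2 + η)) ≤ criticalTwoPoint 3 x ∧
      criticalTwoPoint 3 x ≤ C'' * (‖x‖ : ℝ) ^ (-(((3 : ℕ) : ℝ) - 2 + η))
  have h3 : ((3 : ℕ) : ℝ) = (3 : ℝ) := by norm_num
  rw [h3]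
  exact ⟨c', C', hc', fun x hx => ⟨hlow x hx, hC' x hx⟩⟩

end Summit.CriticalPhenomena.Ising3DConformalLimit.Theorems
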